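import Summits.BirchSwinnertonDyer.BirchSwinnertonDyer.Theorems.GenusKolyvaginAtTwoK4NegPhantomTwinLevelFourField
import Summits.BirchSwinnertonDyer.BirchSwinnertonDyer.Theorems.GenusKolyvaginAtTwoGenusPrimitiveSupplyAtTwoTwistLocalFrame
import Literature.NumberTheory.EllipticCurves.Hsieh2014.AnticyclotomicPAdicLFunctionRamifiedSteinbergCorollaries
import HarnessLib

/-!
# Route `GenusKolyvaginAtTwo`, crux K₄⁻ `K4Neg` (stmt-BirchSwinnertonDyer-31526), LINES 37/38 —
# LINE 37's typed proposal `PhantomTwinIffLocTrivial_T` IS A THEOREM: `𝒫(Wd) ⟺ loc_{ℓ₀} ξ_W = 0`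

Width seat `bsd-line-gk2-p4` g35 (cell `bsd-f1-sign2`), WIDTH-5 attach on route `GenusKolyvaginAtTwo` rev 59; second of three files (after
`…K4NegPhantomTwinLevelFourField`: a class dies on `Γ_{ℚ(E[4])}` iff it dies on `Γ_{ℚ(Wd[4])}`), sequel of the lineage's twisting-prime series
§46–§48 (g10) and trace-bit files (g34).  `--supports stmt-BirchSwinnertonDyer-31526 --as helper`.  THEOREMS ONLY (no definition, no named fact,
no `sorry`); standard axioms.  **BSD is NOT proved by this file; `K4Neg` is NOT proved; no item is closed by it.**

SETTING (a prime Heegner frame): `W/ℚ` globally minimal, `Δ_W < 0`, `ρ̄_{W,2}` (and for ★★/★★★ `ρ_{W,4}`) onto; `K` imaginary quadratic with odd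
`d_K = −ℓ₀` (`ℓ₀` prime), Heegner for `N_W`, `2` split; `Wd` ANY elliptic model of `W^{(d_K)}`; `𝒩(Wd)` := «no non-zero class of `Sel₂(Wd)` dies
on `Γ_{ℚ(Wd[4])}`» (the pen's `TwinNonPhantomBit Wd`, LINE 37 «frobenius_split»), `𝒫 := ¬𝒩`.

* §4 `exists_selmer_dying_strict_of_selmer_dying_twist_natCast` / `exists_selmer_dying_twist_of_selmer_dying_strict_natCast` — the two
  TRANSPORTS: a non-zero class of `Sel₂(Wd)` dying on `Γ_{ℚ(Wd[4])}` gives a non-zero class of `Sel₂(W)` dying on `Γ_{ℚ(E[4])}` and STRICT at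
  `v₀ ∣ ℓ₀`, and conversely (previous file §3 + §46 strictness at the ramified prime + §47 class-level transport under the place menu).
  ★★ `exists_selmer_dying_twist_iff_localization_eq_zero_natCast` / `…_iff_mem_torsionLocalKer` — **T: on a Selmer-entangled frame
  (`ξ_W ∈ Sel₂(W)`), `𝒫(Wd) ⟺ loc_{ℓ₀} ξ_W = 0`** (plus Lawson–Wuthrich uniqueness); `phantomTwinIffLocTrivial` = the pen's
  `PhantomTwinIffLocTrivial_T` with binders VERBATIM (`theorem T_holds : PhantomTwinIffLocTrivial_T := by unfold PhantomTwinIffLocTrivial_T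
  TwinNonPhantomBit; exact phantomTwinIffLocTrivial`).  No hypothesis on `#Sel₂(Wd)` or ranks is used.
* Sequel `…K4NegPhantomTwinTraceDictionary`: with the trace bit, `𝒫(Wd) ⟺ 4 ∣ a_{ℓ₀}(W)` on the Selmer-entangled cell and
  `𝒩(Wd) ⟺ (ξ_W ∈ Sel₂(W) ⟹ 4 ∤ a_{ℓ₀}(W))` — `𝒫 = (β)`, `𝒩 = (α) ∪ {bit TRUE}`.

References: [MazurRubin2010] Def. 3.1, Lemma 2.10–2.11, Prop. 3.3, Remark 2.4; [LawsonWuthrich2016] §3 (Lemma 6, p = 2), §7.1;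
[GrossLMS1991] §9 Prop. 9.1, 9.6; [Kramer1981] Prop. 7; [Marcus2018] Ch. 3 Thm. 34; [SilvermanAEC2009] Thm. V.2.3.1, X.5 Cor. 5.4.
-/

set_option linter.dupNamespace false -- `Summit.<P>.<Sub>` repeats `BirchSwinnertonDyer` (D-0017)
set_option autoImplicit false

noncomputable section

open scoped Classical Pointwise ContRepresentation

namespace Summit.BirchSwinnertonDyer.BirchSwinnertonDyer.Theorems.GenusExact.PhantomDescentBit.TwinLevelFour

open WeierstrassCurve Field NumberField IsDedekindDomain
open Literature.NumberTheory.GaloisRepresentations Literature.NumberTheory.EllipticCurves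
open Literature.NumberTheory
open Rat.HeightOneSpectrum (primesEquiv)
open Summit.BirchSwinnertonDyer.BirchSwinnertonDyer.Theorems.GenusKolyTwistingPrime
open Literature.NumberTheory.GaloisRepresentations.DiscreteGaloisModule (SelmerStructure)
open Literature.NumberTheory.GaloisCohomology
open Summit.BirchSwinnertonDyer.Rank1Residual.X11b.CongruentTransfer
open Summit.BirchSwinnertonDyer.Rank1Residual.X11b.Levels (map_map_eq_self_of_comp_eq)
open Summit.BirchSwinnertonDyer.BirchSwinnertonDyer.Theorems.GenusKolyTwistLocal

universe u

/-! ## §4 T as a theorem: `𝒫(Wd) ⟺ loc_{ℓ₀} ξ_W = 0` on a Selmer-entangled prime Heegner frame -/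

section PhantomTwin

variable (W : WeierstrassCurve ℚ) [W.IsElliptic] [W.IsGloballyMinimal] {K : Type} [Field K] [NumberField K]

omit [W.IsGloballyMinimal] in
/-- Lawson–Wuthrich uniqueness (g8 `eq_of_forall_torsionFixing_four_h1Eval_eq_zero`) with the classes spelled at level `((2 : ℕ) : ℤ)`.
[cite: LawsonWuthrich2016, §3 (Lemma 6 and the case p = 2)] -/
theorem eq_of_forall_torsionFixing_four_h1Eval_eq_zero_natCast (hsurj : W.HasSurjectiveModNGaloisRep 2)
    (hsurj4 : W.HasSurjectiveModNGaloisRep 4) {x y : galH1Torsion W ((2 : ℕ) : ℤ)} (hx0 : x ≠ 0) (hy0 : y ≠ 0)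
    (hx : ∀ h ∈ torsionFixing W (4 : ℤ), h1Eval W ((2 : ℕ) : ℤ) x h = 0)
    (hy : ∀ h ∈ torsionFixing W (4 : ℤ), h1Eval W ((2 : ℕ) : ℤ) y h = 0) : x = y := by
  have e2 : ((2 : ℕ) : ℤ) = (2 : ℤ) := by norm_num
  revert x y
  rw [e2]
  intro x y hx0 hy0 hx hy
  exact eq_of_forall_torsionFixing_four_h1Eval_eq_zero W hsurj hsurj4 hx0 hy0 hx hy

/-- **THE TRANSPORT DATA OF THE PRIME HEEGNER TWIN** (gk2-p5 / gk2-p4 g10, packaged): inverse intertwinings `φ : Wd[2] ⇄ E[2] : ψ` and the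
transported Kummer structure `𝓐 = φ_* 𝓚_{Wd}` on `H¹(ℚ, E[2])`, AGREEING with `𝓚_W` at every place `v ≠ v₀` (`v₀ ∣ ℓ₀`): Mazur–Rubin Lemma 2.10
(i) at the split places `2`, `p ∣ N_W` (Heegner), (iv) at `∞` (`Δ < 0`), (ii) at the good odd places (place menu `twist_place_menu_finite_rat` /
`_infinite_rat`, `transport_twist_agree_off_inr`). [cite: MazurRubin2010, Remark 2.4, Lemma 2.10 (i), (ii), (iv) (arXiv:0904.3709 p. 7)] -/
theorem exists_twist_transport (hΔ : W.Δ < 0) (hK : IsImaginaryQuadratic K)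
    (hH : SatisfiesHeegnerHypothesis (W.conductorNorm ℤ) K) (h2K : ((Ideal.span {(2 : ℤ)}).primesOver (𝓞 K)).ncard = 2)
    {ℓ : ℕ} [Fact ℓ.Prime] (hd : discr K = -(ℓ : ℤ)) {Wd : WeierstrassCurve ℚ} [Wd.IsElliptic] {C : VariableChange ℚ}
    (hWd : C • W.quadraticTwist (discr K : ℚ) = Wd) {v₀ : HeightOneSpectrum (𝓞 ℚ)} (hℓv₀ : (ℓ : 𝓞 ℚ) ∈ v₀.asIdeal) :
    ∃ (φ : (Wd.torsionGaloisModule ((2 : ℕ) : ℤ)).toContRepresentation →ⁱL (W.torsionGaloisModule ((2 : ℕ) : ℤ)).toContRepresentation)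
      (ψ : (W.torsionGaloisModule ((2 : ℕ) : ℤ)).toContRepresentation →ⁱL (Wd.torsionGaloisModule ((2 : ℕ) : ℤ)).toContRepresentation)
      (𝓐 : SelmerStructure (W.torsionGaloisModule ((2 : ℕ) : ℤ))),
      (∀ a, ψ (φ a) = a) ∧ (∀ b, φ (ψ b) = b) ∧
      (∀ v, 𝓐 v = (Wd.kummerSelmerStructure ((2 : ℕ) : ℤ) v).map (galoisCohomology.map (φ.restrictField (Place.Completion v)) 1)) ∧
      (∀ v : Place ℚ, v ≠ Sum.inr v₀ → 𝓐 v = W.kummerSelmerStructure ((2 : ℕ) : ℤ) v) := by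
  have hℓ : ℓ.Prime := Fact.out
  have hd0 : (discr K : ℚ) ≠ 0 := by
    rw [hd]
    push_cast
    exact neg_ne_zero.mpr (by exact_mod_cast hℓ.ne_zero)
  obtain ⟨φ, ψ, hψφ, hφψ, hsplit⟩ := exists_intertwining_hsplit W hd0 hWd
  refine ⟨φ, ψ, fun v ↦ (Wd.kummerSelmerStructure ((2 : ℕ) : ℤ) v).map (galoisCohomology.map (φ.restrictField (Place.Completion v)) 1),
    hψφ, hφψ, fun _ ↦ rfl, ?_⟩
  exact transport_twist_agree_off_inr W Wd φ ψ hφψ hsplit _ (fun _ ↦ rfl) v₀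
    (twist_place_menu_finite_rat W hK.1 hH h2K hℓ hd hℓv₀ hWd) (twist_place_menu_infinite_rat W hΔ hd0 hWd)

/-- **TRANSPORT ⟹: a non-zero class of `Sel₂(Wd)` dying on `Γ_{ℚ(Wd[4])}` transports to a non-zero class of `Sel₂(W)` dying on
`Γ_{ℚ(E[4])}` and STRICT at the place `v₀` over `ℓ₀`**: the class dies on `Γ_{ℚ(E[4])}` (previous file §3), hence is strict at `v₀`
(§46: the inertia fixes `E[4]`, so `loc_{v₀}` is unramified, while the twist's Kummer line is ramified — Mazur–Rubin Lemma 2.11), hence lies in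
`H¹_𝓐 ∩ Sel^{v₀}` and maps INTO `Sel₂(W)` (§47), keeping its evaluations (`[H¹(φ)c, ρ] = φ[c, ρ]`).
[cite: MazurRubin2010, Def. 3.1, Lemma 2.10–2.11, Prop. 3.3 (arXiv:0904.3709 pp. 7–10)] [cite: LawsonWuthrich2016, §3] -/
theorem exists_selmer_dying_strict_of_selmer_dying_twist_natCast (hsurj : W.HasSurjectiveModNGaloisRep 2)
    (hΔ : W.Δ < 0) (hK : IsImaginaryQuadratic K) (hodd : Odd (discr K))
    (hH : SatisfiesHeegnerHypothesis (W.conductorNorm ℤ) K) (h2K : ((Ideal.span {(2 : ℤ)}).primesOver (𝓞 K)).ncard = 2)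
    {ℓ : ℕ} [Fact ℓ.Prime] (hd : discr K = -(ℓ : ℤ)) {Wd : WeierstrassCurve ℚ} [Wd.IsElliptic] {C : VariableChange ℚ}
    (hWd : C • W.quadraticTwist (discr K : ℚ) = Wd)
    {c : galH1Torsion Wd ((2 : ℕ) : ℤ)} (hcS : c ∈ Wd.selmerGroup ((2 : ℕ) : ℤ)) (hc0 : c ≠ 0)
    (hcdies : ∀ h ∈ torsionFixing Wd (4 : ℤ), h1Eval Wd ((2 : ℕ) : ℤ) c h = 0)
    {v₀ : HeightOneSpectrum (𝓞 ℚ)} (hℓv₀ : (ℓ : 𝓞 ℚ) ∈ v₀.asIdeal) :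
    ∃ y ∈ W.selmerGroup ((2 : ℕ) : ℤ), y ≠ 0 ∧ (∀ h ∈ torsionFixing W (4 : ℤ), h1Eval W ((2 : ℕ) : ℤ) y h = 0) ∧
      galoisCohomology.localization (W.torsionGaloisModule ((2 : ℕ) : ℤ)) (Sum.inr v₀) 1 y = 0 := by
  classical
  haveI : Fact (Nat.Prime 2) := ⟨Nat.prime_two⟩
  have hℓ : ℓ.Prime := Fact.out
  have e2 : ((2 : ℕ) : ℤ) = 2 := by norm_num
  obtain ⟨hℓ2, hℓN, -⟩ := GenusKolyTwin.prime_discr_facts W hK hodd hH hℓ hd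
  have hv₀ : ((primesEquiv v₀ : Nat.Primes) : ℕ) = ℓ := primesEquiv_eq hℓ hℓv₀
  have hd0 : (discr K : ℚ) ≠ 0 := by
    rw [hd]
    push_cast
    exact neg_ne_zero.mpr (by exact_mod_cast hℓ.ne_zero)
  have hW : W.HasGoodReductionAt v₀ := by
    by_contra h
    exact hℓN (hv₀ ▸ (W.dvd_conductorNorm_iff v₀).mpr h)
  have h2v₀ : ((2 : ℕ) : 𝓞 ℚ) ∉ v₀.asIdeal :=
    natCast_not_mem_of_not_dvd hℓ hℓv₀ fun h ↦ hℓ2 ((Nat.prime_dvd_prime_iff_eq hℓ Nat.prime_two).mp h)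
  have h4v₀ : ((4 : ℤ) : 𝓞 ℚ) ∉ v₀.asIdeal := by
    have h4 : ((4 : ℕ) : 𝓞 ℚ) ∉ v₀.asIdeal :=
      natCast_not_mem_of_not_dvd hℓ hℓv₀ fun h ↦ hℓ2 ((Nat.prime_dvd_prime_iff_eq hℓ Nat.prime_two).mp
        (hℓ.dvd_of_dvd_pow (show ℓ ∣ 2 ^ 2 by simpa using h)))
    have e : ((4 : ℤ) : 𝓞 ℚ) = ((4 : ℕ) : 𝓞 ℚ) := by push_cast; rfl
    rw [e]
    exact h4
  have hram : ∃ π c : ℚ, v₀.valuation ℚ π = WithZero.exp (-1 : ℤ) ∧ (discr K : ℚ) = c ^ 2 * π :=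
    ⟨(discr K : ℚ), 1, by
      rw [hd]
      push_cast
      exact GenusKolyTwistRamified.valuation_neg_natCast_eq_exp_neg_one_of_mem v₀ hℓ hℓv₀,
      by rw [one_pow, one_mul]⟩
  have hT4' : torsionFixing W (4 : ℤ) ≤ torsionFixing W ((2 : ℕ) : ℤ) := by
    rw [e2]
    exact KolyvaginLowerBoundAtTwo.torsionFixing_le_of_dvd W (by norm_num)
  obtain ⟨φ, ψ, 𝓐, hψφ, -, h𝓐, hagree⟩ := exists_twist_transport W hΔ hK hH h2K hd hWd hℓv₀
  -- the class dies on `Γ_{ℚ(E[4])}` (§3), hence is strict at `v₀` (§46), hence transports into `Sel₂(W)` (§47)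
  have hcdiesW : ∀ h ∈ torsionFixing W (4 : ℤ), h1Eval Wd ((2 : ℕ) : ℤ) c h = 0 :=
    (forall_torsionFixing_four_twist_h1Eval_eq_zero_iff_natCast W hsurj hd0 hWd c).mpr hcdies
  have hcS' : c ∈ (Wd.kummerSelmerStructure ((2 : ℕ) : ℤ)).selmerGroup := by
    rw [← selmerGroup_eq_selmerGroup_kummerSelmerStructure]; exact hcS
  have hcv₀ : galoisCohomology.localization (Wd.torsionGaloisModule ((2 : ℕ) : ℤ)) (Sum.inr v₀) 1 c ∈
      Wd.kummerLocalConditionAt ((2 : ℕ) : ℤ) (v₀.adicCompletion ℚ) := by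
    have h := (SelmerStructure.mem_selmerGroup_iff _ _).mp hcS' (Sum.inr v₀)
    rwa [kummerSelmerStructure_apply] at h
  have hloc0 := localization_eq_zero_of_kummer_of_forall_torsionFixing_four_h1Eval_eq_zero W hd0 hWd v₀ h2v₀ h4v₀ hW
    hram hcv₀ hcdiesW
  obtain ⟨hyS, hy0⟩ := map_mem_selmer_of_localization_eq_zero W Wd 2 φ 𝓐 h𝓐 v₀ hagree hcS' hloc0
  refine ⟨galoisCohomology.map φ 1 c, ?_, ?_, ?_, hy0⟩
  · rw [selmerGroup_eq_selmerGroup_kummerSelmerStructure]; exact hyS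
  · intro h0
    apply hc0
    have h := map_map_eq_self_of_comp_eq φ ψ hψφ c
    rw [h0] at h
    rw [← h]
    exact map_zero _
  · intro h hh
    have e := h1Eval_galoisCohomology_map Wd W ((2 : ℕ) : ℤ) φ c (ρ := h) (hT4' hh)
    rw [hcdiesW h hh, map_zero] at e
    exact e

/-- **TRANSPORT ⟸: a non-zero class of `Sel₂(W)` dying on `Γ_{ℚ(E[4])}` and STRICT at `v₀` is the transport of a non-zero class of
`Sel₂(Wd)` dying on `Γ_{ℚ(Wd[4])}`** (`Sel_{v₀} ⊂ H¹_𝓐 = φ_* Sel₂(Wd)`, §47; then previous file §3).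
[cite: MazurRubin2010, Def. 3.1, Lemma 2.10, Prop. 3.3 (arXiv:0904.3709 pp. 7–10)] [cite: LawsonWuthrich2016, §3] -/
theorem exists_selmer_dying_twist_of_selmer_dying_strict_natCast (hsurj : W.HasSurjectiveModNGaloisRep 2)
    (hΔ : W.Δ < 0) (hK : IsImaginaryQuadratic K)
    (hH : SatisfiesHeegnerHypothesis (W.conductorNorm ℤ) K) (h2K : ((Ideal.span {(2 : ℤ)}).primesOver (𝓞 K)).ncard = 2)
    {ℓ : ℕ} [Fact ℓ.Prime] (hd : discr K = -(ℓ : ℤ)) {Wd : WeierstrassCurve ℚ} [Wd.IsElliptic] {C : VariableChange ℚ}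
    (hWd : C • W.quadraticTwist (discr K : ℚ) = Wd)
    {x : galH1Torsion W ((2 : ℕ) : ℤ)} (hxS : x ∈ W.selmerGroup ((2 : ℕ) : ℤ)) (hx0 : x ≠ 0)
    (hx : ∀ h ∈ torsionFixing W (4 : ℤ), h1Eval W ((2 : ℕ) : ℤ) x h = 0)
    {v₀ : HeightOneSpectrum (𝓞 ℚ)} (hℓv₀ : (ℓ : 𝓞 ℚ) ∈ v₀.asIdeal)
    (hloc : galoisCohomology.localization (W.torsionGaloisModule ((2 : ℕ) : ℤ)) (Sum.inr v₀) 1 x = 0) :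
    ∃ c ∈ Wd.selmerGroup ((2 : ℕ) : ℤ), c ≠ 0 ∧ ∀ h ∈ torsionFixing Wd (4 : ℤ), h1Eval Wd ((2 : ℕ) : ℤ) c h = 0 := by
  classical
  haveI : Fact (Nat.Prime 2) := ⟨Nat.prime_two⟩
  have hℓ : ℓ.Prime := Fact.out
  have e2 : ((2 : ℕ) : ℤ) = 2 := by norm_num
  have hd0 : (discr K : ℚ) ≠ 0 := by
    rw [hd]
    push_cast
    exact neg_ne_zero.mpr (by exact_mod_cast hℓ.ne_zero)
  have hT4' : torsionFixing W (4 : ℤ) ≤ torsionFixing W ((2 : ℕ) : ℤ) := by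
    rw [e2]
    exact KolyvaginLowerBoundAtTwo.torsionFixing_le_of_dvd W (by norm_num)
  obtain ⟨φ, ψ, 𝓐, hψφ, hφψ, h𝓐, hagree⟩ := exists_twist_transport W hΔ hK hH h2K hd hWd hℓv₀
  have hxS' : x ∈ (W.kummerSelmerStructure ((2 : ℕ) : ℤ)).selmerGroup := by
    rw [← selmerGroup_eq_selmerGroup_kummerSelmerStructure]; exact hxS
  obtain ⟨c, hcS, hcy⟩ := exists_selmer_eq_map_of_localization_eq_zero W Wd 2 φ ψ hψφ hφψ 𝓐 h𝓐 v₀ hagree hxS' hloc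
  have hc0 : c ≠ 0 := by
    rintro rfl
    apply hx0
    rw [← hcy]
    exact map_zero _
  have hcdiesW : ∀ h ∈ torsionFixing W (4 : ℤ), h1Eval Wd ((2 : ℕ) : ℤ) c h = 0 := by
    intro h hh
    have e := h1Eval_galoisCohomology_map Wd W ((2 : ℕ) : ℤ) φ c (ρ := h) (hT4' hh)
    rw [hcy, hx h hh] at e
    have e'' := congrArg ψ e
    rw [map_zero, hψφ] at e''
    exact e''.symm
  have hcS' : c ∈ Wd.selmerGroup ((2 : ℕ) : ℤ) := by
    rw [selmerGroup_eq_selmerGroup_kummerSelmerStructure]; exact hcS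
  exact ⟨c, hcS', hc0, (forall_torsionFixing_four_twist_h1Eval_eq_zero_iff_natCast W hsurj hd0 hWd c).mp hcdiesW⟩

/-- ★★ **T AS A THEOREM (localisation form).**  `W/ℚ` globally minimal, `Δ_W < 0`, `ρ̄_{W,2}` and `ρ_{W,4}` onto; `K` imaginary quadratic with
odd `d_K = −ℓ₀` (`ℓ₀` prime), Heegner for `N_W`, `2` split; `Wd` ANY elliptic model of `W^{(d_K)}`; `x ∈ Sel₂(W)` non-zero and dying on
`Γ_{ℚ(E[4])}` (the Lawson–Wuthrich class: the curve is SELMER-ENTANGLED); `v₀` the place of `ℚ` at `ℓ₀`.  THEN: **some non-zero class of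
`Sel₂(Wd)` dies on `Γ_{ℚ(Wd[4])}` (`𝒫(Wd)`) IFF `loc_{v₀} x = 0`** — the two transports plus Lawson–Wuthrich uniqueness.  No hypothesis on
`#Sel₂(Wd)` or on ranks is needed. [cite: MazurRubin2010, Def. 3.1, Lemma 2.10–2.11, Prop. 3.3 (arXiv:0904.3709 pp. 7–10)]
[cite: LawsonWuthrich2016, §3, §7.1] [cite: GrossLMS1991, §9 Prop. 9.1] -/
theorem exists_selmer_dying_twist_iff_localization_eq_zero_natCast
    (hsurj : W.HasSurjectiveModNGaloisRep 2) (hsurj4 : W.HasSurjectiveModNGaloisRep 4)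
    (hΔ : W.Δ < 0) (hK : IsImaginaryQuadratic K) (hodd : Odd (discr K))
    (hH : SatisfiesHeegnerHypothesis (W.conductorNorm ℤ) K) (h2K : ((Ideal.span {(2 : ℤ)}).primesOver (𝓞 K)).ncard = 2)
    {ℓ : ℕ} [Fact ℓ.Prime] (hd : discr K = -(ℓ : ℤ)) {Wd : WeierstrassCurve ℚ} [Wd.IsElliptic] {C : VariableChange ℚ}
    (hWd : C • W.quadraticTwist (discr K : ℚ) = Wd)
    {x : galH1Torsion W ((2 : ℕ) : ℤ)} (hxS : x ∈ W.selmerGroup ((2 : ℕ) : ℤ)) (hx0 : x ≠ 0)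
    (hx : ∀ h ∈ torsionFixing W (4 : ℤ), h1Eval W ((2 : ℕ) : ℤ) x h = 0)
    {v₀ : HeightOneSpectrum (𝓞 ℚ)} (hℓv₀ : (ℓ : 𝓞 ℚ) ∈ v₀.asIdeal) :
    (∃ c ∈ Wd.selmerGroup ((2 : ℕ) : ℤ), c ≠ 0 ∧ ∀ h ∈ torsionFixing Wd (4 : ℤ), h1Eval Wd ((2 : ℕ) : ℤ) c h = 0) ↔
      galoisCohomology.localization (W.torsionGaloisModule ((2 : ℕ) : ℤ)) (Sum.inr v₀) 1 x = 0 := by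
  constructor
  · rintro ⟨c, hcS, hc0, hcdies⟩
    obtain ⟨y, -, hy0, hydies, hyloc⟩ :=
      exists_selmer_dying_strict_of_selmer_dying_twist_natCast W hsurj hΔ hK hodd hH h2K hd hWd hcS hc0 hcdies hℓv₀
    rwa [eq_of_forall_torsionFixing_four_h1Eval_eq_zero_natCast W hsurj hsurj4 hy0 hx0 hydies hx] at hyloc
  · exact exists_selmer_dying_twist_of_selmer_dying_strict_natCast W hsurj hΔ hK hH h2K hd hWd hxS hx0 hx hℓv₀

/-- ★★ **T AS A THEOREM (`torsionLocalKer ℚ_{ℓ₀}` form, the lineage's `(2 : ℤ)` spelling).**  Same frame: **some non-zero class of `Sel₂(Wd)`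
dies on `Γ_{ℚ(Wd[4])}` ⟺ `x ∈ ker (H¹(ℚ, E[2]) → H¹(ℚ_{ℓ₀}, E[2]))`** (`loc_{ℓ₀} ξ_W = 0`).
[cite: MazurRubin2010, Def. 3.1, Lemma 2.10–2.11, Prop. 3.3] [cite: LawsonWuthrich2016, §3, §7.1] [cite: GrossLMS1991, §9 Prop. 9.1, 9.6] -/
theorem exists_selmer_dying_twist_iff_mem_torsionLocalKer
    (hsurj : W.HasSurjectiveModNGaloisRep 2) (hsurj4 : W.HasSurjectiveModNGaloisRep 4)
    (hΔ : W.Δ < 0) (hK : IsImaginaryQuadratic K) (hodd : Odd (discr K))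
    (hH : SatisfiesHeegnerHypothesis (W.conductorNorm ℤ) K) (h2K : ((Ideal.span {(2 : ℤ)}).primesOver (𝓞 K)).ncard = 2)
    {ℓ : ℕ} [Fact ℓ.Prime] (hd : discr K = -(ℓ : ℤ)) {Wd : WeierstrassCurve ℚ} [Wd.IsElliptic] {C : VariableChange ℚ}
    (hWd : C • W.quadraticTwist (discr K : ℚ) = Wd)
    {x : galH1Torsion W (2 : ℤ)} (hxS : x ∈ W.selmerGroup 2) (hx0 : x ≠ 0)
    (hx : ∀ h ∈ torsionFixing W (4 : ℤ), h1Eval W (2 : ℤ) x h = 0) :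
    (∃ c ∈ Wd.selmerGroup 2, c ≠ 0 ∧ ∀ h ∈ torsionFixing Wd (4 : ℤ), h1Eval Wd (2 : ℤ) c h = 0) ↔
      x ∈ W.torsionLocalKer ℚ_[ℓ] (2 : ℤ) := by
  have hℓ : ℓ.Prime := Fact.out
  obtain ⟨v₀, hv₀⟩ : ∃ v : HeightOneSpectrum (𝓞 ℚ), ((primesEquiv v : Nat.Primes) : ℕ) = ℓ :=
    ⟨primesEquiv.symm ⟨ℓ, hℓ⟩, by rw [Equiv.apply_symm_apply]⟩
  have hℓv₀ : (ℓ : 𝓞 ℚ) ∈ v₀.asIdeal := by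
    rw [← hv₀]
    exact Rat.HeightOneSpectrum.natCast_natGenerator_mem v₀
  have e2 : (2 : ℤ) = ((2 : ℕ) : ℤ) := by norm_num
  revert x
  rw [e2]
  intro x hxS hx0 hx
  refine (exists_selmer_dying_twist_iff_localization_eq_zero_natCast W hsurj hsurj4 hΔ hK hodd hH h2K hd hWd hxS hx0 hx
    hℓv₀).trans ?_
  subst hv₀
  exact ⟨fun h ↦ mem_strictLocalKer_of_localization_eq_zero W v₀ h, fun h ↦ localization_eq_zero_of_mem_strictLocalKer W v₀ h⟩

/-- ★★ **THE PEN'S TYPED PROPOSAL `PhantomTwinIffLocTrivial_T` (LINE 37 «frobenius_split», `Cruxes/K4Neg/Lines/frobenius_split.lean`), binders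
VERBATIM** (so that `theorem T_holds : PhantomTwinIffLocTrivial_T := by unfold PhantomTwinIffLocTrivial_T TwinNonPhantomBit; exact
phantomTwinIffLocTrivial` closes it): on an off-cut prime Heegner frame of a non-CM `W` with `Δ < 0`, odd Tamagawa product, `2`-adic tower onto,
`K = ℚ(√−ℓ₀)` Heegner with `2` split, `Wd` a globally minimal twin of positive rank with `#Sel₂(Wd) = 2`, and `x ∈ Sel₂(W)` non-zero dying on
`Γ_{ℚ(E[4])}`: **`¬𝒩(Wd) ⟺ x ∈ ker loc_v` at the place `v` over `ℓ₀`**.  The binders `¬CM`, odd `C`, off-cut, positive rank and `#Sel₂(Wd) = 2` are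
idle (kept for literal matching); `Odd d_K` is recovered from `2` split (`ℓ₀ = 2` would ramify).
[cite: MazurRubin2010, Def. 3.1, Lemma 2.10–2.11, Prop. 3.3] [cite: LawsonWuthrich2016, §3, §7.1] [cite: Marcus2018, Ch. 3 Thm. 34] -/
theorem phantomTwinIffLocTrivial :
    ∀ (W : WeierstrassCurve ℚ) [W.IsElliptic] [W.IsGloballyMinimal] [NeZero (W.conductorNorm ℤ)],
    ¬ W.HasCM → W.Δ < 0 → Odd W.tamagawaProduct →
    (¬ ∃ v : HeightOneSpectrum (𝓞 ℚ), ((2 : ℕ) : 𝓞 ℚ) ∉ v.asIdeal ∧ ((W.conductorNorm ℤ : ℕ) : 𝓞 ℚ) ∈ v.asIdeal ∧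
      W.HasMultiplicativeReductionAt v) →
    (∀ n : ℕ, 0 < n → W.HasSurjectiveModNGaloisRep ((2 : ℤ) ^ n)) →
    ∀ (K : Type) [Field K] [NumberField K], IsImaginaryQuadratic K → SatisfiesHeegnerHypothesis (W.conductorNorm ℤ) K →
    ∀ (ℓ₀ : ℕ), ℓ₀.Prime → NumberField.discr K = -(ℓ₀ : ℤ) → ((Ideal.span {(2 : ℤ)}).primesOver (𝓞 K)).ncard = 2 →
    ∀ (Wd : WeierstrassCurve ℚ) [Wd.IsElliptic] [Wd.IsGloballyMinimal],
    (∃ C : VariableChange ℚ, C • W.quadraticTwist (NumberField.discr K : ℚ) = Wd) → 0 < Wd.mordellWeilRank →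
    Nat.card (Wd.selmerGroup 2) = 2 →
    ∀ x : galH1Torsion W ((2 : ℕ) : ℤ), x ≠ 0 → x ∈ selmerGroup W ((2 : ℕ) : ℤ) →
    (∀ h ∈ torsionFixing W ((4 : ℕ) : ℤ), h1Eval W ((2 : ℕ) : ℤ) x h = 0) →
    ((¬ ∀ x : galH1Torsion Wd ((2 : ℕ) : ℤ), x ∈ selmerGroup Wd ((2 : ℕ) : ℤ) →
        (∀ ρ' ∈ torsionFixing Wd ((4 : ℕ) : ℤ), h1Eval Wd ((2 : ℕ) : ℤ) x ρ' = 0) → x = 0) ↔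
      ∀ v : HeightOneSpectrum (𝓞 ℚ), (ℓ₀ : 𝓞 ℚ) ∈ v.asIdeal → x ∈ W.torsionLocalKer (v.adicCompletion ℚ) ((2 : ℕ) : ℤ)) := by
  intro W _ _ _ _ hΔ _ _ hρ K _ _ hK hH ℓ₀ hℓ₀ hd h2K Wd _ _ hWd _ _ x hx0 hxS hx
  haveI : Fact ℓ₀.Prime := ⟨hℓ₀⟩
  obtain ⟨C, hC⟩ := hWd
  have hsurj : W.HasSurjectiveModNGaloisRep 2 := by simpa using hρ 1 one_pos
  have hsurj4 : W.HasSurjectiveModNGaloisRep 4 := by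
    have h := hρ 2 two_pos
    norm_num at h
    exact h
  have hℓ2 : ℓ₀ ≠ 2 := by
    rintro rfl
    exact Hsieh2014.ncard_primesOver_ne_two_of_dvd_discr K hK.1 Nat.prime_two (by rw [hd]; norm_num) h2K
  have hodd : Odd (discr K) := by
    rw [hd, odd_neg, ← Int.not_even_iff_odd, Int.even_coe_nat]
    exact fun h ↦ hℓ2 ((Nat.Prime.even_iff hℓ₀).mp h)
  have e4 : ((4 : ℕ) : ℤ) = (4 : ℤ) := by norm_num
  rw [e4] at hx
  -- the place over `ℓ₀` is unique, so the `∀ v` of the statement is the single place `v₀`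
  constructor
  · intro hN v hℓv
    have hv : ((primesEquiv v : Nat.Primes) : ℕ) = ℓ₀ := primesEquiv_eq hℓ₀ hℓv
    have hex : ∃ c ∈ Wd.selmerGroup ((2 : ℕ) : ℤ), c ≠ 0 ∧ ∀ h ∈ torsionFixing Wd (4 : ℤ), h1Eval Wd ((2 : ℕ) : ℤ) c h = 0 := by
      by_contra hcon
      apply hN
      intro c hcS hcdies
      by_contra hc0
      rw [e4] at hcdies
      exact hcon ⟨c, hcS, hc0, hcdies⟩
    have hloc := (exists_selmer_dying_twist_iff_localization_eq_zero_natCast W hsurj hsurj4 hΔ hK hodd hH h2K hd hC hxS hx0 hx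
      hℓv).mp hex
    exact (mem_torsionLocalKer_iff_localization_eq_zero_rat W v x).mpr hloc
  · intro hall hN
    obtain ⟨v₀, hv₀⟩ : ∃ v : HeightOneSpectrum (𝓞 ℚ), ((primesEquiv v : Nat.Primes) : ℕ) = ℓ₀ :=
      ⟨primesEquiv.symm ⟨ℓ₀, hℓ₀⟩, by rw [Equiv.apply_symm_apply]⟩
    have hℓv₀ : (ℓ₀ : 𝓞 ℚ) ∈ v₀.asIdeal := by
      rw [← hv₀]
      exact Rat.HeightOneSpectrum.natCast_natGenerator_mem v₀
    have hloc := (mem_torsionLocalKer_iff_localization_eq_zero_rat W v₀ x).mp (hall v₀ hℓv₀)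
    obtain ⟨c, hcS, hc0, hcdies⟩ := (exists_selmer_dying_twist_iff_localization_eq_zero_natCast W hsurj hsurj4 hΔ hK hodd hH h2K
      hd hC hxS hx0 hx hℓv₀).mpr hloc
    rw [← e4] at hcdies
    exact hc0 (hN c hcS hcdies)

end PhantomTwin

end Summit.BirchSwinnertonDyer.BirchSwinnertonDyer.Theorems.GenusExact.PhantomDescentBit.TwinLevelFour

end
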